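import Mathlib
import HarnessLib

/-!
# Route `PoloidalWindowDoor`, crux `PoloidalWindowRigidity` (K2, stmt-NavierStokesRegularity-19708) — LINE 14 `loop_island` (ns-idea-8 g7),
# tools for STUB Z `stub_loopsPersist`: a regular closed orbit of a planar Hamiltonian field is an ISOLATED piece of its level set

Cell ns-regularity-ideate, seat ns-poloidal-K2-p2 g12 (stub-worker on K2; `--supports` the crux item).  Pure ODE / calculus on
`ℝ³ = EuclideanSpace ℝ (Fin 3)`, no Navier–Stokes content.

Setting: `ψ : ℝ³ → ℝ` of class `C¹`, `X` the horizontal Hamiltonian field of `ψ` (`X₀ = ∂₁ψ`, `X₁ = −∂₀ψ`, `X₂ = 0`), and a periodic orbit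
`γ` of `X` (`γ′ = X(γ)`, period `ℓ > 0`).
* `fderiv_apply_eq_sum_three` — `Dψ(y) w = w₀ ∂₀ψ + w₁ ∂₁ψ + w₂ ∂₂ψ`; `hamiltonian_first_integral` — `Dψ(X) = 0`;
* `orbit_level`, `orbit_planar` — `ψ ∘ γ` and `(γ ·)₂` are constant;
* `field_ne_zero_along_orbit` — if `X ∈ C¹` and `X (γ 0) ≠ 0` then `X (γ θ) ≠ 0` for all `θ` (uniqueness of solutions: a stationary
  point on the orbit would make the orbit constant);
* `level_locally_orbit` — LOCAL UNIQUENESS at a point `p = γ θ₀` of the orbit: some ball around `p` meets the planar level set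
  `{ψ = ψ(p)} ∩ {y₂ = p₂}` only along `range γ` (one-dimensional argument: `ψ` is strictly monotone along the coordinate direction
  `eᵢ` with `∂ᵢψ(p) ≠ 0` near `p`, and the complementary coordinate of the orbit sweeps a neighbourhood of `pⱼ` by the intermediate
  value theorem, so a level point near `p` shares both planar coordinates with an orbit point);
* `exists_level_tube` — by compactness (Lebesgue number) a uniform radius: every point of the plane of the orbit within `infDist < r`
  of `range γ` and on the level `ψ = ψ(γ 0)` lies ON the orbit.

WHAT THIS IS NOT: not a claim about Navier–Stokes regularity — calculus for one provable stub of an ideator line of a door route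
(bears_on LADDER-NS N0, rung N0-LocalTubeDoorPoloidal); crux 19708 is OPEN.
-/

noncomputable section

-- the summit and its single sub-problem share the name (CONVENTIONS §1), as in every Theorems file
set_option linter.dupNamespace false

namespace Summit.NavierStokesRegularity.NavierStokesRegularity.Theorems.PoloidalWindowDoorPoloidalWindowRigidityLevelTube

open MeasureTheory Set Function Filter Topology Metric
open scoped RealInnerProductSpace InnerProductSpace NNReal

/-! ### Coordinates -/

/-- `Dψ(y) w = w₀ ∂₀ψ + w₁ ∂₁ψ + w₂ ∂₂ψ`. [folklore] -/
theorem fderiv_apply_eq_sum_three (ψ : EuclideanSpace ℝ (Fin 3) → ℝ) (y w : EuclideanSpace ℝ (Fin 3)) :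
    fderiv ℝ ψ y w = w 0 * fderiv ℝ ψ y (EuclideanSpace.single 0 1) + w 1 * fderiv ℝ ψ y (EuclideanSpace.single 1 1) +
      w 2 * fderiv ℝ ψ y (EuclideanSpace.single 2 1) := by
  have e : w = (w 0) • EuclideanSpace.single 0 (1 : ℝ) + (w 1) • EuclideanSpace.single 1 (1 : ℝ) +
      (w 2) • EuclideanSpace.single 2 (1 : ℝ) := by
    ext i; fin_cases i <;> simp
  conv_lhs => rw [e]
  simp only [map_add, map_smul, smul_eq_mul]

/-- **The Hamiltonian is a first integral of its horizontal Hamiltonian field**: `Dψ(X) = ∂₁ψ ∂₀ψ − ∂₀ψ ∂₁ψ = 0`. [folklore] -/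
theorem hamiltonian_first_integral {ψ : EuclideanSpace ℝ (Fin 3) → ℝ} {X : EuclideanSpace ℝ (Fin 3) → EuclideanSpace ℝ (Fin 3)}
    (hX0 : ∀ y, X y 0 = fderiv ℝ ψ y (EuclideanSpace.single 1 1)) (hX1 : ∀ y, X y 1 = -fderiv ℝ ψ y (EuclideanSpace.single 0 1))
    (hX2 : ∀ y, X y 2 = 0) (y : EuclideanSpace ℝ (Fin 3)) : fderiv ℝ ψ y (X y) = 0 := by
  rw [fderiv_apply_eq_sum_three, hX0, hX1, hX2]; ring

/-! ### The orbit: level, plane, regularity -/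

variable {ψ : EuclideanSpace ℝ (Fin 3) → ℝ} {X : EuclideanSpace ℝ (Fin 3) → EuclideanSpace ℝ (Fin 3)}
  {γ : ℝ → EuclideanSpace ℝ (Fin 3)} {ℓ : ℝ}

/-- A `C¹` function with `Df(X) ≡ 0` is constant along trajectories of `X` defined on `ℝ`. [folklore] -/
theorem apply_orbit_eq {φ : EuclideanSpace ℝ (Fin 3) → ℝ} (hφ : Differentiable ℝ φ) (hφX : ∀ y, fderiv ℝ φ y (X y) = 0)
    (hγ : ∀ θ, HasDerivAt γ (X (γ θ)) θ) (θ : ℝ) : φ (γ θ) = φ (γ 0) := by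
  have hd : ∀ t, HasDerivAt (φ ∘ γ) 0 t := fun t => by
    have h := (hφ (γ t)).hasFDerivAt.comp_hasDerivAt t (hγ t)
    rwa [hφX] at h
  exact is_const_of_deriv_eq_zero (fun t => (hd t).differentiableAt) (fun t => (hd t).deriv) θ 0

/-- The Hamiltonian is constant along the orbit. [folklore] -/
theorem orbit_level (hψ : ContDiff ℝ 1 ψ)
    (hX0 : ∀ y, X y 0 = fderiv ℝ ψ y (EuclideanSpace.single 1 1)) (hX1 : ∀ y, X y 1 = -fderiv ℝ ψ y (EuclideanSpace.single 0 1))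
    (hX2 : ∀ y, X y 2 = 0) (hγ : ∀ θ, HasDerivAt γ (X (γ θ)) θ) (θ : ℝ) : ψ (γ θ) = ψ (γ 0) :=
  apply_orbit_eq (hψ.differentiable one_ne_zero) (hamiltonian_first_integral hX0 hX1 hX2) hγ θ

/-- The orbit of a horizontal field is planar: `(γ θ)₂ = (γ 0)₂`. [folklore] -/
theorem orbit_planar (hX2 : ∀ y, X y 2 = 0) (hγ : ∀ θ, HasDerivAt γ (X (γ θ)) θ) (θ : ℝ) : γ θ 2 = γ 0 2 := by
  have hφ : Differentiable ℝ (⇑(EuclideanSpace.proj (𝕜 := ℝ) (2 : Fin 3))) :=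
    (EuclideanSpace.proj (𝕜 := ℝ) (2 : Fin 3)).differentiable
  have hφX : ∀ y, fderiv ℝ (⇑(EuclideanSpace.proj (𝕜 := ℝ) (2 : Fin 3))) y (X y) = 0 := fun y => by
    rw [(EuclideanSpace.proj (𝕜 := ℝ) (2 : Fin 3)).fderiv]
    simpa using hX2 y
  simpa using apply_orbit_eq hφ hφX hγ θ

/-- A periodic orbit has compact range (`range γ = γ '' [0, ℓ]`). [folklore] -/
theorem isCompact_range_of_periodic (hcont : Continuous γ) (hℓ : 0 < ℓ) (hper : ∀ θ, γ (θ + ℓ) = γ θ) :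
    IsCompact (Set.range γ) := by
  have hp : Function.Periodic γ ℓ := hper
  have h : Set.range γ = γ '' Set.Icc 0 ℓ := by
    refine Subset.antisymm ?_ (image_subset_range _ _)
    rintro _ ⟨θ, rfl⟩
    obtain ⟨θ', hθ', heq⟩ := hp.exists_mem_Ico₀ hℓ θ
    exact ⟨θ', Ico_subset_Icc_self hθ', heq.symm⟩
  rw [h]
  exact (isCompact_Icc).image hcont

/-- **The field does not vanish along a non-stationary orbit** (`X ∈ C¹`): otherwise the orbit would be the constant solution through
the stationary point (uniqueness, `ODE_solution_unique_univ` on a ball containing the bounded orbit, where `X` is Lipschitz). [folklore] -/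
theorem field_ne_zero_along_orbit (hX : ContDiff ℝ 1 X) (hγ : ∀ θ, HasDerivAt γ (X (γ θ)) θ) (hℓ : 0 < ℓ)
    (hper : ∀ θ, γ (θ + ℓ) = γ θ) (hne : X (γ 0) ≠ 0) (θ : ℝ) : X (γ θ) ≠ 0 := by
  intro hzero
  have hcont : Continuous γ := continuous_iff_continuousAt.2 fun t => (hγ t).continuousAt
  -- a ball containing the orbit, on which `X` is Lipschitz
  obtain ⟨R, hR⟩ := (isCompact_range_of_periodic hcont hℓ hper).isBounded.subset_closedBall 0
  set s : Set (EuclideanSpace ℝ (Fin 3)) := closedBall 0 (R + 1) with hs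
  have hγs : ∀ t, γ t ∈ s := fun t => closedBall_subset_closedBall (by linarith) (hR ⟨t, rfl⟩)
  obtain ⟨M, hM⟩ := (isCompact_closedBall (0 : EuclideanSpace ℝ (Fin 3)) (R + 1)).exists_bound_of_continuousOn
    ((hX.continuous_fderiv one_ne_zero).continuousOn)
  have hlip : LipschitzOnWith (Real.toNNReal M) X s := by
    refine (convex_closedBall _ _).lipschitzOnWith_of_nnnorm_fderiv_le (fun x _ => (hX.differentiable one_ne_zero) x) (fun x hx => ?_)
    have h := hM x hx
    exact_mod_cast (show ‖fderiv ℝ X x‖ ≤ (Real.toNNReal M : ℝ) from h.trans (Real.le_coe_toNNReal M))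
  -- uniqueness: `γ` is the constant solution through `γ θ`
  have huniq := ODE_solution_unique_univ (v := fun _ => X) (s := fun _ => s) (t₀ := θ) (f := γ) (g := fun _ => γ θ)
    (fun _ => hlip) (fun t => ⟨hγ t, hγs t⟩)
    (fun t => ⟨by rw [hzero]; exact hasDerivAt_const t (γ θ), hγs θ⟩) rfl
  have h0 : γ 0 = γ θ := congrFun huniq 0
  exact hne (by rw [h0]; exact hzero)

/-! ### Local uniqueness of the level set along the orbit -/

/-- **Strict monotonicity along a coordinate direction**: if `∂ᵢψ` has constant sign `≠ 0` on a ball, two distinct points of the ball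
differing by a multiple of `eᵢ` have different values of `ψ`. [folklore] -/
theorem apply_ne_of_translate {B : Set (EuclideanSpace ℝ (Fin 3))} (hB : Convex ℝ B) (hψ : Differentiable ℝ ψ)
    (e : EuclideanSpace ℝ (Fin 3)) (hpos : (∀ y ∈ B, 0 < fderiv ℝ ψ y e) ∨ (∀ y ∈ B, fderiv ℝ ψ y e < 0))
    {y : EuclideanSpace ℝ (Fin 3)} {t : ℝ} (hy : y ∈ B) (hyt : y + t • e ∈ B) (ht : t ≠ 0) : ψ (y + t • e) ≠ ψ y := by
  -- `g τ = ψ (y + τ e)` is strictly monotone on the segment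
  set g : ℝ → ℝ := fun τ => ψ (y + τ • e) with hg
  have hgd : ∀ τ, HasDerivAt g (fderiv ℝ ψ (y + τ • e) e) τ := fun τ => by
    have hl : HasDerivAt (fun τ : ℝ => y + τ • e) e τ := by
      simpa using ((hasDerivAt_id τ).smul_const e).const_add y
    exact (hψ (y + τ • e)).hasFDerivAt.comp_hasDerivAt τ hl
  have hseg : ∀ τ ∈ Set.uIcc 0 t, y + τ • e ∈ B := by
    intro τ hτ
    -- `y + τ e` is a convex combination of `y` and `y + t e`
    obtain ⟨a, b, ha, hb, hab, hτab⟩ : ∃ a b : ℝ, 0 ≤ a ∧ 0 ≤ b ∧ a + b = 1 ∧ τ = b * t := by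
      rcases le_or_gt 0 t with h | h
      · rw [Set.uIcc_of_le h] at hτ
        refine ⟨1 - τ / t, τ / t, by rw [sub_nonneg, div_le_one (lt_of_le_of_ne h ht.symm)]; exact hτ.2,
          div_nonneg hτ.1 h, by ring, by rw [div_mul_cancel₀ _ ht]⟩
      · rw [Set.uIcc_of_ge h.le] at hτ
        refine ⟨1 - τ / t, τ / t, ?_, div_nonneg_of_nonpos hτ.2 h.le, by ring, by rw [div_mul_cancel₀ _ ht]⟩
        rw [sub_nonneg, div_le_one_of_neg h]; exact hτ.1
    have h := hB hy hyt ha hb hab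
    have e1 : a • y + b • (y + t • e) = y + τ • e := by
      rw [hτab, smul_add, ← add_assoc, ← add_smul, hab, one_smul, smul_smul]
    rwa [e1] at h
  intro heq
  -- Rolle / MVT: some point of the segment has zero derivative
  have hgt : g t = g 0 := by simp only [hg, zero_smul, add_zero]; exact heq
  obtain ⟨τ, hτ, hτ0⟩ : ∃ τ ∈ Set.uIcc 0 t, fderiv ℝ ψ (y + τ • e) e = 0 := by
    rcases lt_or_gt_of_ne ht with h | h
    · obtain ⟨τ, hτ, h0⟩ := exists_hasDerivAt_eq_zero (f' := fun τ => fderiv ℝ ψ (y + τ • e) e) h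
        (fun τ _ => (hgd τ).continuousAt.continuousWithinAt) hgt (fun τ _ => hgd τ)
      exact ⟨τ, by rw [Set.uIcc_of_ge h.le]; exact Ioo_subset_Icc_self hτ, h0⟩
    · obtain ⟨τ, hτ, h0⟩ := exists_hasDerivAt_eq_zero (f' := fun τ => fderiv ℝ ψ (y + τ • e) e) h
        (fun τ _ => (hgd τ).continuousAt.continuousWithinAt) hgt.symm (fun τ _ => hgd τ)
      exact ⟨τ, by rw [Set.uIcc_of_le h.le]; exact Ioo_subset_Icc_self hτ, h0⟩
  rcases hpos with hp | hp
  · exact absurd hτ0 (hp _ (hseg τ hτ)).ne'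
  · exact absurd hτ0 (hp _ (hseg τ hτ)).ne

/-- **LOCAL UNIQUENESS of the planar level set at a point of a regular orbit.**  `ψ ∈ C¹`; a continuous curve `γ` in the plane
`{y₂ = p₂}` through `p = γ θ₀` on which `ψ = c₀`; indices `{i, j} = {0, 1}` with `∂ᵢψ(p) ≠ 0` and the `j`-th coordinate of `γ`
differentiable at `θ₀` with non-zero derivative.  Then some ball around `p` meets `{ψ = c₀} ∩ {y₂ = p₂}` only along `range γ`. [folklore] -/
theorem level_locally_orbit (hψ : ContDiff ℝ 1 ψ) {i j : Fin 3}
    (hcoord : ∀ y q : EuclideanSpace ℝ (Fin 3), y j = q j → y 2 = q 2 → y = q + (y i - q i) • EuclideanSpace.single i (1 : ℝ))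
    {θ₀ : ℝ} {c₀ : ℝ} (hγc : Continuous γ) (hlev : ∀ θ, ψ (γ θ) = c₀) (hpl : ∀ θ, γ θ 2 = γ θ₀ 2)
    (hDi : fderiv ℝ ψ (γ θ₀) (EuclideanSpace.single i 1) ≠ 0) {dj : ℝ} (hdj : HasDerivAt (fun θ => γ θ j) dj θ₀) (hdj0 : dj ≠ 0) :
    ∃ ε : ℝ, 0 < ε ∧ ∀ y : EuclideanSpace ℝ (Fin 3), dist y (γ θ₀) < ε → y 2 = γ θ₀ 2 → ψ y = c₀ → y ∈ Set.range γ := by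
  set p := γ θ₀ with hp
  set e : EuclideanSpace ℝ (Fin 3) := EuclideanSpace.single i 1 with he
  have hψd : Differentiable ℝ ψ := hψ.differentiable one_ne_zero
  -- (1) a ball on which `∂ᵢψ` keeps the sign of `∂ᵢψ(p)`
  have hDc : Continuous fun y => fderiv ℝ ψ y e := (hψ.continuous_fderiv one_ne_zero).clm_apply continuous_const
  obtain ⟨a, ha, hsign⟩ : ∃ a : ℝ, 0 < a ∧ ((∀ y ∈ ball p a, 0 < fderiv ℝ ψ y e) ∨ (∀ y ∈ ball p a, fderiv ℝ ψ y e < 0)) := by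
    rcases lt_or_gt_of_ne hDi with h | h
    · have hopen : IsOpen {y | fderiv ℝ ψ y e < 0} := isOpen_lt hDc continuous_const
      obtain ⟨a, ha, hball⟩ := Metric.isOpen_iff.1 hopen p h
      exact ⟨a, ha, Or.inr fun y hy => hball hy⟩
    · have hopen : IsOpen {y | 0 < fderiv ℝ ψ y e} := isOpen_lt continuous_const hDc
      obtain ⟨a, ha, hball⟩ := Metric.isOpen_iff.1 hopen p h
      exact ⟨a, ha, Or.inl fun y hy => hball hy⟩
  -- (2) the `j`-coordinate of the orbit sweeps a neighbourhood of `p j`, staying in the half ball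
  have hγat : ∀ᶠ θ in 𝓝 θ₀, γ θ ∈ ball p (a / 2) :=
    hγc.continuousAt.preimage_mem_nhds (ball_mem_nhds _ (by positivity))
  -- sign of the increments of `h θ = γ θ j`: `0 < (γ θ j - p j) (θ - θ₀) dj` near `θ₀`
  have hslope : ∀ᶠ θ in 𝓝[≠] θ₀, 0 < (γ θ j - p j) / (θ - θ₀) * dj := by
    have ht := hdj.tendsto_slope
    have h2 : Tendsto (fun θ => slope (fun θ => γ θ j) θ₀ θ * dj) (𝓝[≠] θ₀) (𝓝 (dj * dj)) := ht.mul_const dj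
    filter_upwards [h2.eventually (lt_mem_nhds (mul_self_pos.2 hdj0))] with θ hθ
    rw [slope_def_field] at hθ
    simpa [hp] using hθ
  obtain ⟨τ, hτ, hτprop⟩ : ∃ τ > 0, ∀ θ, dist θ θ₀ < τ →
      γ θ ∈ ball p (a / 2) ∧ (θ ≠ θ₀ → 0 < (γ θ j - p j) * (θ - θ₀) * dj) := by
    have h2 : ∀ᶠ θ in 𝓝 θ₀, θ ≠ θ₀ → 0 < (γ θ j - p j) * (θ - θ₀) * dj := by
      filter_upwards [eventually_nhdsWithin_iff.1 hslope] with θ hθ hne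
      have h := hθ (mem_compl_singleton_iff.2 hne)
      have hb : θ - θ₀ ≠ 0 := sub_ne_zero.2 hne
      have e : (γ θ j - p j) / (θ - θ₀) * dj = ((γ θ j - p j) * (θ - θ₀) * dj) / (θ - θ₀) ^ 2 := by
        field_simp
      rw [e] at h
      exact (div_pos_iff_of_pos_right (by positivity)).1 h
    obtain ⟨τ, hτ, h⟩ := Metric.eventually_nhds_iff.1 (hγat.and h2)
    exact ⟨τ, hτ, fun θ hθ => h hθ⟩
  set θm := θ₀ - τ / 2 with hθm
  set θp := θ₀ + τ / 2 with hθp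
  have hdm : dist θm θ₀ < τ := by
    rw [Real.dist_eq, hθm, show θ₀ - τ / 2 - θ₀ = -(τ / 2) by ring, abs_neg, abs_of_pos (by positivity)]; linarith
  have hdp : dist θp θ₀ < τ := by
    rw [Real.dist_eq, hθp, show θ₀ + τ / 2 - θ₀ = τ / 2 by ring, abs_of_pos (by positivity)]; linarith
  -- the values `γ θm j`, `γ θp j` lie strictly on opposite sides of `p j`
  have hm' : (γ θm j - p j) * dj < 0 := by
    have h := (hτprop θm hdm).2 (by rw [hθm]; linarith)
    rw [show θm - θ₀ = -(τ / 2) by rw [hθm]; ring,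
      show (γ θm j - p j) * -(τ / 2) * dj = -(τ / 2) * ((γ θm j - p j) * dj) by ring] at h
    rcases pos_and_pos_or_neg_and_neg_of_mul_pos h with ⟨h1, _⟩ | ⟨_, h2⟩
    · exfalso; linarith
    · exact h2
  have hp' : 0 < (γ θp j - p j) * dj := by
    have h := (hτprop θp hdp).2 (by rw [hθp]; linarith)
    rw [show θp - θ₀ = τ / 2 by rw [hθp]; ring,
      show (γ θp j - p j) * (τ / 2) * dj = (τ / 2) * ((γ θp j - p j) * dj) by ring] at h
    rcases pos_and_pos_or_neg_and_neg_of_mul_pos h with ⟨_, h2⟩ | ⟨h1, _⟩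
    · exact h2
    · exfalso; linarith
  set a' : ℝ := min |γ θm j - p j| |γ θp j - p j| with ha'
  have ha'pos : 0 < a' := by
    have h1 : γ θm j - p j ≠ 0 := fun h => by rw [h] at hm'; simp at hm'
    have h2 : γ θp j - p j ≠ 0 := fun h => by rw [h] at hp'; simp at hp'
    exact lt_min (abs_pos.2 h1) (abs_pos.2 h2)
  -- (3) the radius
  refine ⟨min (a / 2) a', lt_min (by positivity) ha'pos, fun y hyd hy2 hyc => ?_⟩
  have hya : dist y p < a / 2 := lt_of_lt_of_le hyd (min_le_left _ _)
  have hya' : |y j - p j| < a' := by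
    refine lt_of_le_of_lt ?_ (lt_of_lt_of_le hyd (min_le_right _ _))
    have := PiLp.norm_apply_le (y - p) j
    simpa [dist_eq_norm, Real.norm_eq_abs] using this
  have hy1 := lt_of_lt_of_le hya' (min_le_left _ _)
  have hy2' := lt_of_lt_of_le hya' (min_le_right _ _)
  -- intermediate value: some `θ ∈ [θm, θp]` has `γ θ j = y j`
  have hyj_between : y j ∈ Set.uIcc (γ θm j) (γ θp j) := by
    rcases lt_or_gt_of_ne hdj0 with hneg | hpos
    · -- dj < 0: γ θm j > p j > γ θp j
      have hm1 : 0 < γ θm j - p j := by nlinarith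
      have hp1 : γ θp j - p j < 0 := by nlinarith
      rw [abs_of_pos hm1] at hy1
      rw [abs_of_neg hp1] at hy2'
      rw [abs_lt] at hy1 hy2'
      rw [Set.uIcc_of_ge (by linarith), Set.mem_Icc]
      constructor <;> linarith
    · have hm1 : γ θm j - p j < 0 := by nlinarith
      have hp1 : 0 < γ θp j - p j := by nlinarith
      rw [abs_of_neg hm1] at hy1
      rw [abs_of_pos hp1] at hy2'
      rw [abs_lt] at hy1 hy2'
      rw [Set.uIcc_of_le (by linarith), Set.mem_Icc]
      constructor <;> linarith
  have hcj : Continuous fun θ => γ θ j := (EuclideanSpace.proj (𝕜 := ℝ) j).continuous.comp hγc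
  obtain ⟨θ, hθ, hθy⟩ : ∃ θ ∈ Set.uIcc θm θp, γ θ j = y j :=
    intermediate_value_uIcc hcj.continuousOn hyj_between
  -- the orbit point `q = γ θ` lies in the half ball
  have hθdist : dist θ θ₀ < τ := by
    rw [Set.uIcc_of_le (by rw [hθm, hθp]; linarith)] at hθ
    rw [dist_eq_norm, Real.norm_eq_abs, abs_lt, hθm, hθp] at *
    constructor <;> linarith [hθ.1, hθ.2]
  have hq : γ θ ∈ ball p (a / 2) := (hτprop θ hθdist).1
  -- `y` and `q` differ by a multiple of `eᵢ`; both in `ball p a`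
  have hyq : y = γ θ + (y i - γ θ i) • e := hcoord y (γ θ) hθy.symm (by rw [hy2, hpl θ])
  have hyB : y ∈ ball p a := ball_subset_ball (by linarith) (mem_ball.2 hya)
  have hqB : γ θ ∈ ball p a := ball_subset_ball (by linarith) hq
  by_cases ht : y i - γ θ i = 0
  · rw [ht, zero_smul, add_zero] at hyq
    exact ⟨θ, hyq.symm⟩
  · exfalso
    have hne := apply_ne_of_translate (convex_ball p a) hψd e hsign hqB (by rw [← hyq]; exact hyB) ht
    rw [← hyq, hyc, hlev θ] at hne
    exact hne rfl

/-- **A UNIFORM TUBE**: for `ψ ∈ C¹`, its horizontal Hamiltonian field `X ∈ C¹` and a non-stationary periodic orbit `γ` of `X`, there is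
`r > 0` such that every point of the plane of the orbit within `infDist < r` of `range γ` on the level `ψ = ψ (γ 0)` lies on the orbit.
[folklore] -/
theorem exists_level_tube (hψ : ContDiff ℝ 1 ψ) (hX : ContDiff ℝ 1 X)
    (hX0 : ∀ y, X y 0 = fderiv ℝ ψ y (EuclideanSpace.single 1 1)) (hX1 : ∀ y, X y 1 = -fderiv ℝ ψ y (EuclideanSpace.single 0 1))
    (hX2 : ∀ y, X y 2 = 0) (hγ : ∀ θ, HasDerivAt γ (X (γ θ)) θ) (hℓ : 0 < ℓ) (hper : ∀ θ, γ (θ + ℓ) = γ θ)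
    (hne : X (γ 0) ≠ 0) :
    ∃ r : ℝ, 0 < r ∧ ∀ y : EuclideanSpace ℝ (Fin 3), y 2 = γ 0 2 → Metric.infDist y (Set.range γ) < r →
      ψ y = ψ (γ 0) → y ∈ Set.range γ := by
  have hγc : Continuous γ := continuous_iff_continuousAt.2 fun t => (hγ t).continuousAt
  have hlev : ∀ θ, ψ (γ θ) = ψ (γ 0) := orbit_level hψ hX0 hX1 hX2 hγ
  have hpl : ∀ θ, γ θ 2 = γ 0 2 := orbit_planar hX2 hγ
  have hreg : ∀ θ, X (γ θ) ≠ 0 := field_ne_zero_along_orbit hX hγ hℓ hper hne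
  -- pointwise radii
  have hpt : ∀ θ₀ : ℝ, ∃ ε : ℝ, 0 < ε ∧ ∀ y : EuclideanSpace ℝ (Fin 3), dist y (γ θ₀) < ε → y 2 = γ θ₀ 2 →
      ψ y = ψ (γ 0) → y ∈ Set.range γ := by
    intro θ₀
    have hpl' : ∀ θ, γ θ 2 = γ θ₀ 2 := fun θ => by rw [hpl θ, hpl θ₀]
    -- derivative of the coordinates of `γ` at `θ₀`
    have hdcoord : ∀ k : Fin 3, HasDerivAt (fun θ => γ θ k) (X (γ θ₀) k) θ₀ := fun k =>
      ((EuclideanSpace.proj (𝕜 := ℝ) k).hasFDerivAt.comp_hasDerivAt θ₀ (hγ θ₀))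
    by_cases h1 : fderiv ℝ ψ (γ θ₀) (EuclideanSpace.single 1 1) = 0
    · -- then `∂₀ψ ≠ 0`: monotone in `e₀`, the orbit's coordinate `1` moves (`X₁ = -∂₀ψ ≠ 0`)
      have h0 : fderiv ℝ ψ (γ θ₀) (EuclideanSpace.single 0 1) ≠ 0 := by
        intro h0
        apply hreg θ₀
        ext k; fin_cases k
        · simpa [hX0] using h1
        · simpa [hX1] using h0
        · simpa using hX2 (γ θ₀)
      refine level_locally_orbit hψ (i := 0) (j := 1) (fun y q hj h2 => ?_) hγc hlev hpl' h0 (hdcoord 1)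
        (by rw [hX1]; exact neg_ne_zero.2 h0)
      ext k; fin_cases k <;> simp [hj, h2]
    · refine level_locally_orbit hψ (i := 1) (j := 0) (fun y q hj h2 => ?_) hγc hlev hpl' h1 (hdcoord 0)
        (by rw [hX0]; exact h1)
      ext k; fin_cases k <;> simp [hj, h2]
  -- Lebesgue number over the compact orbit
  choose ε hε hprop using hpt
  have hK : IsCompact (Set.range γ) := isCompact_range_of_periodic hγc hℓ hper
  obtain ⟨r, hr, hleb⟩ := lebesgue_number_lemma_of_metric hK (c := fun θ => ball (γ θ) (ε θ)) (fun θ => isOpen_ball)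
    (by rintro _ ⟨θ, rfl⟩; exact mem_iUnion.2 ⟨θ, mem_ball_self (hε θ)⟩)
  refine ⟨r, hr, fun y hy2 hyd hyc => ?_⟩
  obtain ⟨x, hx, hxy⟩ := (Metric.infDist_lt_iff (Set.range_nonempty γ)).1 hyd
  obtain ⟨θ, hθ⟩ := hleb x hx
  have hyball : y ∈ ball (γ θ) (ε θ) := hθ (mem_ball.2 hxy)
  exact hprop θ y (mem_ball.1 hyball) (by rw [hy2, hpl θ]) hyc

end Summit.NavierStokesRegularity.NavierStokesRegularity.Theorems.PoloidalWindowDoorPoloidalWindowRigidityLevelTube
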